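import Summits.BirchSwinnertonDyer.Rank1Residual.ManinAdditive.ShimuraFiveRootNumber
import Literature.NumberTheory.EllipticCurves.RootNumberTableLocalInvarianceProofs
import Literature.NumberTheory.DiophantineGeometry.LocalReductionProofs
import HarnessLib

/-!
# The local law L5 split into a one-parameter family computation and a moduli statement
# (cell bsd-f2-manin, es g43 ROAD δ part 2; MEMO-es §66.8 P.S.)

Cell bsd-f2-manin, seat es (planner), gen 43.  Typed rows over tree declarations; every row is an `@[conjecture] def … : Prop`.
The local law L5 (`SplitFiveTorsionRootNumberLaw`, E-es-235: a rational point of order `5` + `W[5]` fixed by `Gal(ℚ̄/ℚ(μ₅))` + additive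
at `5` ⟹ `w₅(W) = −1`) is the conjunction of
* E-es-239 `SplitFiveTorsionModuli` — MODULI: such a `W` is, up to a change of variables over `ℚ`, a fibre `E'_{s⁵}` of the Vélu family
  `veluFive b := [1 − b, −b, −b, −5b(b² + 2b − 1), −b(b⁴ + 10b³ − 5b² + 15b − 1)]` = `E_b/⟨(0,0)⟩` (`E_b` the Tate normal form with a point of
  order `5`; `W/μ₅ =: E` carries the rational `5`-point image of `t`, so `E = E_b` and `W ≅ E_b/⟨(0,0)⟩`; the extension
  `0 → μ₅ → E'_b[5] → ℤ/5 → 0` splits iff the Kummer class of `b` in `ℚˣ/ℚˣ⁵` is trivial, i.e. `b = s⁵`) — consistent with all seven `5Cs.1.1`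
  curves of conductor `< 350000` (`s = 1, 2, 3, −2, 3/2, −3, 1/4` ↦ `11a1, 1342c2, 33825be2, 550k2, 165066d2, 185163a2, 192698c2`);
* E-es-238 `VeluFiveFamilyRootNumberLaw` — FAMILY COMPUTATION: every elliptic fibre `veluFive (s⁵)` that is additive at `5` has `w₅ = −1`.
  PAPER PROOF (rigorous residue-class computation, HOME/es/g43/L5-residue-proof-g43.txt d395ea79a86db3c8, script l5_residue_proof.py
  87bb5fb1c31aa3d8): `Δ(veluFive b) = b(b² − 11b − 1)⁵`; for `s ∈ ℤ₅`, `s ≡ 3 (mod 5)`: `c₄ ≡ 0 (mod 5⁵)` (all classes mod `5⁵`), `c₆ ≡ 0 (mod 5⁶)`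
  (all classes mod `5⁶`), `v₅(s¹⁰ − 11s⁵ − 1) = 3` exactly (all classes mod `5⁴`) ⟹ `v₅(Δ_min) = 3`, `5 ∣ c₄,min`: additive, Kodaira `III`,
  `e = 4`, `w₅ = (−2|5) = −1` (Rohrlich); `s ≢ 3 (mod 5)` or `v₅(s) < 0` ⟹ good or multiplicative at `5`.  Census `|u|, v ≤ 400`:
  32 384 / 32 384 additive fibres of type `III` (L5-family-check-B400-g43.txt eb9acd283b87c95e).
EDGE `splitFiveTorsionRootNumberLaw_of_family : E-es-238 → E-es-239 → E-es-235`, by the tree THEOREMS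
`WeierstrassCurve.localRootNumberAt_variableChange` (Rohrlich's `W_v` is attached to the curve) and
`WeierstrassCurve.hasAdditiveReductionAt_smul_iff_holds` (additive reduction is attached to the curve); composite edge to E-es-227.
BSD is not proved here; C2/C3 untouched; E-es-224/227/235 remain OPEN.
[cite: Rohrlich1993Compositio, Prop. 2] [cite: Rohrlich1994CRM, §19] [cite: SilvermanAEC2009, VII.5 Prop. 5.1(c)] [cite: ByeonKim2014, Thm. 1.1]
-/

set_option autoImplicit false

noncomputable section

open WeierstrassCurve Literature.NumberTheory.EllipticCurves IsDedekindDomain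
open Summit.BirchSwinnertonDyer.Rank1Residual.ManinAdditive

namespace Summit.BirchSwinnertonDyer.Rank1Residual.ManinAdditive.EsG43

/-- The Vélu quotient `E_b/⟨(0,0)⟩` of the Tate normal form `E_b : y² + (1 − b)xy − by = x³ − bx²` by its rational subgroup of order `5`:
`[a₁, a₂, a₃, a₄, a₆] = [1 − b, −b, −b, −5b(b² + 2b − 1), −b(b⁴ + 10b³ − 5b² + 15b − 1)]`, discriminant `b(b² − 11b − 1)⁵`
(`b = 1`: `[0, −1, −1, −10, −20] ≅ 11a1`).  With `b = s⁵` this is the `5Cs.1.1` family (`W[5] ≅ ℤ/5 ⊕ μ₅`). [folklore] -/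
def veluFive (b : ℚ) : WeierstrassCurve ℚ :=
  ⟨1 - b, -b, -b, -5 * b * (b ^ 2 + 2 * b - 1), -b * (b ^ 4 + 10 * b ^ 3 - 5 * b ^ 2 + 15 * b - 1)⟩

/-- **E-es-238 `VeluFiveFamilyRootNumberLaw`** (FAMILY COMPUTATION; paper proof by residue classes mod `5⁴/5⁵/5⁶`, MEMO-es §66.8 P.S.).
Every elliptic fibre `veluFive (s⁵)`, `s ∈ ℚ`, that is additive at `5` has Rohrlich local root number `w₅ = −1`
(indeed Kodaira type `III`, `e = 4`). [cite: Rohrlich1993Compositio, Prop. 2] -/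
@[conjecture] def VeluFiveFamilyRootNumberLaw : Prop :=
  ∀ (s : ℚ) [(veluFive (s ^ 5)).IsElliptic],
    (veluFive (s ^ 5)).HasAdditiveReductionAt ((Rat.HeightOneSpectrum.primesEquiv (R := ℤ)).symm ⟨5, by norm_num⟩) →
    (veluFive (s ^ 5)).localRootNumberAt ((Rat.HeightOneSpectrum.primesEquiv (R := ℤ)).symm ⟨5, by norm_num⟩) = -1

/-- **E-es-239 `SplitFiveTorsionModuli`** (MODULI of `ℤ/5 ⊕ μ₅`; Kummer theory of the Vélu `5`-isogeny, cf. the `5Cs.1.1` locus).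
An elliptic `W / ℚ` with a rational point of order `5` whose `5`-torsion is fixed by every `σ` fixing `μ₅` is, after a change of
variables over `ℚ`, a fibre `veluFive (s⁵)` for some `s ∈ ℚ`. [cite: ByeonKim2014, Thm. 1.1] -/
@[conjecture] def SplitFiveTorsionModuli : Prop :=
  ∀ (W : WeierstrassCurve ℚ) [W.IsElliptic], (∃ t : W.toAffine.Point, addOrderOf t = 5) →
    (∀ σ : Field.absoluteGaloisGroup ℚ, (∀ ζ : AlgebraicClosure ℚ, ζ ^ 5 = 1 → σ • ζ = ζ) →
      ∀ T : W.geomTorsion 5, σ • T = T) →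
    ∃ (s : ℚ) (C : WeierstrassCurve.VariableChange ℚ), C • W = veluFive (s ^ 5)

/-- **EDGE: L5 from the family computation and the moduli statement.**  E-es-238 → E-es-239 → E-es-235, transporting additive reduction
and Rohrlich's local root number along the change of variables by the tree theorems
`WeierstrassCurve.hasAdditiveReductionAt_smul_iff_holds` and `WeierstrassCurve.localRootNumberAt_variableChange`.
[cite: Rohrlich1994CRM, §19] [cite: SilvermanAEC2009, VII.5 Prop. 5.1(c)] -/
theorem splitFiveTorsionRootNumberLaw_of_family (h₁ : VeluFiveFamilyRootNumberLaw) (h₂ : SplitFiveTorsionModuli) :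
    SplitFiveTorsionRootNumberLaw := by
  intro W _ ht hσ hadd
  obtain ⟨s, C, hV⟩ := h₂ W ht hσ
  haveI hE : (veluFive (s ^ 5)).IsElliptic := by rw [← hV]; infer_instance
  have hadd' : (veluFive (s ^ 5)).HasAdditiveReductionAt
      ((Rat.HeightOneSpectrum.primesEquiv (R := ℤ)).symm ⟨5, by norm_num⟩) := by
    rw [← hV]
    exact (WeierstrassCurve.hasAdditiveReductionAt_smul_iff_holds
      ((Rat.HeightOneSpectrum.primesEquiv (R := ℤ)).symm ⟨5, by norm_num⟩) W C).mpr hadd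
  have h := h₁ s hadd'
  rw [← hV, WeierstrassCurve.localRootNumberAt_variableChange C W] at h
  exact h

/-- **COMPOSITE EDGE to E-es-227**: the family computation, the moduli statement and the two named facts (Carayol; `λ_p = w_p`) give
`ShimuraFiveNoTwentyFive` («`5 ∣ [Λ₀:Λ₁] ⟹ 25 ∤ N`»). [cite: Carayol1986] [cite: KellockDokchitser2023, Rem. 2.2] -/
theorem shimuraFiveNoTwentyFive_of_family (h₁ : VeluFiveFamilyRootNumberLaw) (h₂ : SplitFiveTorsionModuli)
    (hC : ∀ (N : ℕ) [NeZero N], Literature.NumberTheory.EllipticCurves.ModularForms.IsNewformOf.level_eq_conductorNorm (N := N))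
    (hF1 : ∀ W : WeierstrassCurve ℚ, W.atkinLehnerEigenvalueAt_eq_localRootNumberAt) :
    ShimuraFiveNoTwentyFive :=
  shimuraFiveNoTwentyFive_of_splitFiveTorsionRootNumberLaw (splitFiveTorsionRootNumberLaw_of_family h₁ h₂) hC hF1

end Summit.BirchSwinnertonDyer.Rank1Residual.ManinAdditive.EsG43

end
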